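import Mathlib
import HarnessLib
import Summits.MatrixMultiplication.MatrixMultiplication.Theorems.OutsiderSandwichBorderExchange

/-!
# Outsider sandwich — THE BORDER DOOR (II): the core floor survives, the border criminal
# `3 ≤ N̲⋆ ≤ N⋆`, and the record instance `HelpedDeg 3 2 ⟹ θ⋆ ≤ 1/3 < 0.37295`
# (decomp-mm lens-4 «minimal counterexample / extremal reduction», g25)

Beneath the aside leaf `BlockOneIsMM` (item 27147); the cut of record is untouched.  Notation:
`HelpedDeg N B ⟺ ⟨B⟩ ⊠ C₁^{⊠N} ⊵ ⟨2,2,2⟩^{⊠N}` (degeneration; `OutsiderSandwichBorderExchange`),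
`r̲(N) = borderExchangeNumber N ≤ r(N) = exchangeNumber N`, `θ⋆ = exchangeExponent`,
`P = symCore`, `N⋆ = coreBeatLevel` (g24), core ceiling `⌊(4^N−1)/3^N⌋` (`2,3,4,5,7,9` for `N = 3…8`).

1. **The symmetric-core floor survives the border door.** The first gauge point `ζ⁽¹⁾` is a universal
   spectral point, hence DEGENERATION-monotone: `⟨B⟩ ⊠ H^{⊠N} ⊵ ⟨2,2,2⟩^{⊠N} ⟹ 4^N ≤ B·|ι|^N`
   (`helpedDegBy_floor₁`), so **`SymHelpedDeg N B ⟹ 4^N ≤ B·3^N`**: a border certificate at `(3,2)`,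
   `(4,3)` or `(5,4)` is necessarily ENTANGLED (does not factor through `P`).
2. **The border criminal.** `CoreBeatenDeg N :⟺ HelpedDeg N ⌊(4^N−1)/3^N⌋ ⟺ r̲(N)·3^N < 4^N`;
   `CoreBeaten ⟹ CoreBeatenDeg`; the least border-beaten level **`N̲⋆ := borderBeatLevel`** exists with
   **`3 ≤ N̲⋆ ≤ N⋆`**, below it even border certificates cost the core floor, at it the cheapest border
   certificate is not a core one; **`N̲⋆ = 3 ⟺ HelpedDeg 3 2`** (census I69's border-like valley at
   `(N,B) = (3,2)`, typed), `N̲⋆ = 4 ⟺ ¬HelpedDeg 3 2 ∧ HelpedDeg 4 3`, `Helped 3 2 ⟹ N̲⋆ = N⋆ = 3`.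
3. **The record instance.** `HelpedDeg N 2 ⟹ θ⋆ ≤ 1/N`; **`HelpedDeg 3 2 ⟹ θ⋆ ≤ 1/3 < 0.37295`** —
   one border certificate `⟨2⟩ ⊠ C₁^{⊠3} ⊵ ⟨8,8,8⟩` would be the first bound on the exchange exponent
   NOT inherited from an upper bound on `ω` (tree `exchangeExponent_le_leGall`).  The border dichotomy:
   `r̲ ≡ 2` on `N ≥ 1` (and then the leaf HOLDS) or some level has `r̲(N) ≥ 3`.

[Strassen1988, Thm. 3.8]; [ChristandlVranaZuiddam2023, Example 1.4]; [Blaser2013, Thm. 6.3];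
[LeGall2014, Table 2]; [BurgisserClausenShokrollahi1997, (15.20), (15.25)].
-/

noncomputable section

open Literature.Computability.AlgebraicComplexity
open Summit.MatrixMultiplication.MatrixMultiplication.Theorems.OutsiderSandwichCoupling (coupling₁)
open Summit.MatrixMultiplication.MatrixMultiplication.Theorems.OutsiderSandwichExchangeRate
open Summit.MatrixMultiplication.MatrixMultiplication.Theorems.OutsiderSandwichExchangeExponent
open Summit.MatrixMultiplication.MatrixMultiplication.Theorems.OutsiderSandwichExchangeSpectral
open Summit.MatrixMultiplication.MatrixMultiplication.Theorems.OutsiderSandwichExchangeLevelTwo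
  (exchangeNumber_two)
open Summit.MatrixMultiplication.MatrixMultiplication.Theorems.OutsiderSandwichSymmetricCore
  (symCore coupling₁_restrictsTo_symCore SymHelped flatteningRank_le_card flatteningRank_matMul_two)
open Summit.MatrixMultiplication.MatrixMultiplication.Theorems.OutsiderSandwichCoreBeatLevel

open Summit.MatrixMultiplication.MatrixMultiplication.Theorems.OutsiderSandwichBorderExchange

namespace Summit.MatrixMultiplication.MatrixMultiplication.Theorems.OutsiderSandwichBorderCriminal

variable {ι κ μ : Type} [Fintype ι] [Fintype κ] [Fintype μ]

/-! ## 4. The symmetric-core floor survives the border door -/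

/-- **The first-leg floor for border certificates**: `⟨B⟩ ⊠ H^{⊠N} ⊵ ⟨2,2,2⟩^{⊠N}` forces
`4^N ≤ B · |ι|^N` — the first gauge point is a universal spectral point, hence DEGENERATION-monotone,
multiplicative, `= 4` on `⟨2,2,2⟩` and `≤ #slices`. [cite: ChristandlVranaZuiddam2023, Example 1.4] -/
theorem helpedDegBy_floor₁ {H : ι → κ → μ → ℂ} {N B : ℕ} (h : HelpedDegBy H N B) :
    4 ^ N ≤ B * Fintype.card ι ^ N := by
  have hm := pow_le_of_helpedDegBy h (gaugePoint₁_isUniversalSpectralPoint ℂ)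
  rw [gaugePoint₁_eq, gaugePoint₁_eq, flatteningRank_matMul_two] at hm
  have hc : ((flatteningRank H : ℕ) : ℝ) ≤ Fintype.card ι := by
    exact_mod_cast flatteningRank_le_card H
  have h2 : (B : ℝ) * ((flatteningRank H : ℕ) : ℝ) ^ N ≤ (B : ℝ) * (Fintype.card ι : ℝ) ^ N :=
    mul_le_mul_of_nonneg_left (pow_le_pow_left₀ (by positivity) hc N) (by positivity)
  exact_mod_cast hm.trans h2

/-- **`SymHelpedDeg N B`** (problem-side definition): a BORDER certificate that factors through the
symmetric core `P` (`⟨B⟩ ⊠ P^{⊠N} ⊵ ⟨2,2,2⟩^{⊠N}`). -/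
def SymHelpedDeg (N B : ℕ) : Prop :=
  HelpedDegBy symCore N B

/-- `SymHelped ⟹ SymHelpedDeg`. [cite: BurgisserClausenShokrollahi1997, (15.20)] -/
theorem symHelpedDeg_of_symHelped {N B : ℕ} (h : SymHelped N B) : SymHelpedDeg N B :=
  TensorRestrictsTo.algDegeneratesTo h

/-- A core border certificate is a border certificate (`C₁ ≥ P`). [cite: BurgisserClausenShokrollahi1997, (15.25)] -/
theorem helpedDeg_of_symHelpedDeg {N B : ℕ} (h : SymHelpedDeg N B) : HelpedDeg N B :=
  HelpedDegBy.of_restrictsTo coupling₁_restrictsTo_symCore h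

/-- **The floor survives: `SymHelpedDeg N B ⟹ 4^N ≤ B · 3^N`.** [cite: ChristandlVranaZuiddam2023, Example 1.4] -/
theorem symHelpedDeg_floor {N B : ℕ} (h : SymHelpedDeg N B) : 4 ^ N ≤ B * 3 ^ N := by
  simpa using helpedDegBy_floor₁ h

/-- Below the floor there is no core border certificate. [cite: ChristandlVranaZuiddam2023, Example 1.4] -/
theorem not_symHelpedDeg_of_lt {N B : ℕ} (h : B * 3 ^ N < 4 ^ N) : ¬ SymHelpedDeg N B := fun hs =>
  absurd (symHelpedDeg_floor hs) (not_le.2 h)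

/-- **A border certificate at `(3,2)` (or `(4,3)`, `(5,4)`) is necessarily entangled.**
[cite: ChristandlVranaZuiddam2023, Example 1.4] -/
theorem not_symHelpedDeg_table : ¬ SymHelpedDeg 3 2 ∧ ¬ SymHelpedDeg 4 3 ∧ ¬ SymHelpedDeg 5 4 :=
  ⟨not_symHelpedDeg_of_lt (by norm_num), not_symHelpedDeg_of_lt (by norm_num),
    not_symHelpedDeg_of_lt (by norm_num)⟩

/-! ## 5. The border criminal `N̲⋆ ≤ N⋆` -/

/-- **`CoreBeatenDeg N`** (problem-side definition): a level-`N` BORDER certificate strictly cheaper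
than the symmetric-core floor, `HelpedDeg N ⌊(4^N − 1)/3^N⌋`. -/
def CoreBeatenDeg (N : ℕ) : Prop :=
  HelpedDeg N (coreCeiling N)

/-- `CoreBeatenDeg N ⟺ ∃ B, HelpedDeg N B ∧ B·3^N < 4^N`. [folklore] -/
theorem coreBeatenDeg_iff_exists (N : ℕ) : CoreBeatenDeg N ↔ ∃ B : ℕ, HelpedDeg N B ∧ B * 3 ^ N < 4 ^ N :=
  ⟨fun h => ⟨_, h, mul_lt_iff_le_coreCeiling.2 le_rfl⟩,
    fun ⟨_, hB, hlt⟩ => helpedDeg_mono hB (mul_lt_iff_le_coreCeiling.1 hlt)⟩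

/-- `CoreBeatenDeg N ⟺ r̲(N)·3^N < 4^N`. [folklore] -/
theorem coreBeatenDeg_iff_borderExchangeNumber (N : ℕ) :
    CoreBeatenDeg N ↔ borderExchangeNumber N * 3 ^ N < 4 ^ N := by
  rw [CoreBeatenDeg, helpedDeg_iff_borderExchangeNumber_le, mul_lt_iff_le_coreCeiling]

/-- Restriction-beaten levels are border-beaten: `CoreBeaten N ⟹ CoreBeatenDeg N`. [cite: BurgisserClausenShokrollahi1997, (15.20)] -/
theorem coreBeatenDeg_of_coreBeaten {N : ℕ} (h : CoreBeaten N) : CoreBeatenDeg N :=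
  helpedDeg_of_helped ((coreBeaten_iff N).1 h)

/-- **The border table**: `CoreBeatenDeg N` for `N = 3, 4, 5, 6` is `HelpedDeg N B` at
`(N, B) = (3,2), (4,3), (5,4), (6,5)`. [folklore] -/
theorem coreBeatenDeg_table :
    (CoreBeatenDeg 3 ↔ HelpedDeg 3 2) ∧ (CoreBeatenDeg 4 ↔ HelpedDeg 4 3) ∧
      (CoreBeatenDeg 5 ↔ HelpedDeg 5 4) ∧ (CoreBeatenDeg 6 ↔ HelpedDeg 6 5) := by
  refine ⟨?_, ?_, ?_, ?_⟩ <;> simp [CoreBeatenDeg, coreCeiling]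

/-- Levels `0, 1, 2` are not border-beaten (`r̲ ≥ 2 >` ceiling `≤ 1`). [cite: Blaser2013, Thm. 6.3] -/
theorem not_coreBeatenDeg_of_le_two {N : ℕ} (hN : N ≤ 2) : ¬ CoreBeatenDeg N := by
  intro h
  interval_cases N
  · exact not_helpedDeg_zero 0 (by simpa [CoreBeatenDeg, coreCeiling] using h)
  · have h2 := two_le_of_helpedDeg le_rfl h
    simp [coreCeiling] at h2
  · have h2 := two_le_of_helpedDeg (by norm_num) h
    simp [coreCeiling] at h2

/-- Border-beaten levels exist (every restriction-beaten one is). [cite: LeGall2014, Table 2] -/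
theorem exists_coreBeatenDeg : ∃ N : ℕ, CoreBeatenDeg N :=
  exists_coreBeaten.imp fun _ h => coreBeatenDeg_of_coreBeaten h

open scoped Classical in
/-- **`N̲⋆ := borderBeatLevel`** (problem-side definition): the least level at which a BORDER
certificate for the leaf beats every symmetric-core certificate — the border criminal. -/
def borderBeatLevel : ℕ :=
  Nat.find exists_coreBeatenDeg

open scoped Classical in
/-- `N̲⋆` is border-beaten. [cite: LeGall2014, Table 2] -/
theorem coreBeatenDeg_borderBeatLevel : CoreBeatenDeg borderBeatLevel :=
  Nat.find_spec exists_coreBeatenDeg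

open scoped Classical in
/-- Minimality of `N̲⋆`. [folklore] -/
theorem borderBeatLevel_le_of_coreBeatenDeg {N : ℕ} (h : CoreBeatenDeg N) : borderBeatLevel ≤ N :=
  Nat.find_min' exists_coreBeatenDeg h

open scoped Classical in
/-- No level below `N̲⋆` is border-beaten. [folklore] -/
theorem not_coreBeatenDeg_of_lt_borderBeatLevel {N : ℕ} (h : N < borderBeatLevel) : ¬ CoreBeatenDeg N :=
  Nat.find_min exists_coreBeatenDeg h

/-- **`N̲⋆ ≤ N⋆`**: the border criminal sits at or below the restriction criminal. [cite: BurgisserClausenShokrollahi1997, (15.20)] -/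
theorem borderBeatLevel_le_coreBeatLevel : borderBeatLevel ≤ coreBeatLevel :=
  borderBeatLevel_le_of_coreBeatenDeg (coreBeatenDeg_of_coreBeaten coreBeaten_coreBeatLevel)

/-- **`3 ≤ N̲⋆`.** [cite: Blaser2013, Thm. 6.3] -/
theorem three_le_borderBeatLevel : 3 ≤ borderBeatLevel := by
  by_contra h
  exact not_coreBeatenDeg_of_le_two (by omega) coreBeatenDeg_borderBeatLevel

/-- Below `N̲⋆` even border certificates cost the core floor: `N < N̲⋆ ⟹ 4^N ≤ r̲(N)·3^N`. [folklore] -/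
theorem floor_le_of_lt_borderBeatLevel {N : ℕ} (h : N < borderBeatLevel) :
    4 ^ N ≤ borderExchangeNumber N * 3 ^ N :=
  not_lt.1 fun hlt => not_coreBeatenDeg_of_lt_borderBeatLevel h
    ((coreBeatenDeg_iff_borderExchangeNumber N).2 hlt)

/-- At `N̲⋆` the cheapest border certificate beats the floor and is NOT a core border certificate.
[cite: ChristandlVranaZuiddam2023, Example 1.4] -/
theorem not_symHelpedDeg_borderBeatLevel :
    borderExchangeNumber borderBeatLevel * 3 ^ borderBeatLevel < 4 ^ borderBeatLevel ∧
      ¬ SymHelpedDeg borderBeatLevel (borderExchangeNumber borderBeatLevel) :=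
  have hlt := (coreBeatenDeg_iff_borderExchangeNumber _).1 coreBeatenDeg_borderBeatLevel
  ⟨hlt, not_symHelpedDeg_of_lt hlt⟩

/-- **`N̲⋆ = 3 ⟺ HelpedDeg 3 2`** (`⟨2⟩ ⊠ C₁^{⊠3} ⊵ ⟨8,8,8⟩` as a degeneration — census I69's
border-like valley, typed). [cite: LeGall2014, Table 2] -/
theorem borderBeatLevel_eq_three_iff : borderBeatLevel = 3 ↔ HelpedDeg 3 2 := by
  rw [← coreBeatenDeg_table.1]
  exact ⟨fun h => h ▸ coreBeatenDeg_borderBeatLevel,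
    fun h => le_antisymm (borderBeatLevel_le_of_coreBeatenDeg h) three_le_borderBeatLevel⟩

/-- `Helped 3 2 ⟹ N̲⋆ = N⋆ = 3`. [cite: LeGall2014, Table 2] -/
theorem levels_eq_three_of_helped (h : Helped 3 2) : borderBeatLevel = 3 ∧ coreBeatLevel = 3 :=
  ⟨borderBeatLevel_eq_three_iff.2 (helpedDeg_of_helped h), coreBeatLevel_eq_three_iff.2 h⟩

/-- **`N̲⋆ = 4 ⟺ ¬HelpedDeg 3 2 ∧ HelpedDeg 4 3`.** [cite: LeGall2014, Table 2] -/
theorem borderBeatLevel_eq_four_iff : borderBeatLevel = 4 ↔ ¬ HelpedDeg 3 2 ∧ HelpedDeg 4 3 := by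
  rw [← coreBeatenDeg_table.1, ← coreBeatenDeg_table.2.1]
  refine ⟨fun h => ⟨not_coreBeatenDeg_of_lt_borderBeatLevel (by omega), h ▸ coreBeatenDeg_borderBeatLevel⟩,
    fun ⟨h3, h4⟩ => le_antisymm (borderBeatLevel_le_of_coreBeatenDeg h4) ?_⟩
  by_contra hlt
  have e : borderBeatLevel = 3 := by have := three_le_borderBeatLevel; omega
  exact h3 (e ▸ coreBeatenDeg_borderBeatLevel)

/-! ## 6. The record instances: border certificates that would beat the `ω`-inherited bound -/

/-- **`HelpedDeg N 2 ⟹ θ⋆ ≤ 1/N`** (`N ≥ 1`). [cite: Strassen1988, Thm. 3.8] -/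
theorem exchangeExponent_le_inv_of_helpedDeg_two {N : ℕ} (hN : 1 ≤ N) (h : HelpedDeg N 2) :
    exchangeExponent ≤ 1 / N := by
  have h1 := exchangeExponent_le_logb_div_of_helpedDeg hN (by norm_num) h
  have e : Real.logb 2 ((2 : ℕ) : ℝ) = 1 := by push_cast; exact Real.logb_self_eq_one (by norm_num)
  rwa [e] at h1

/-- **`HelpedDeg 3 2 ⟹ θ⋆ ≤ 1/3`**: a border certificate `⟨2⟩ ⊠ C₁^{⊠3} ⊵ ⟨8,8,8⟩` caps the exchange
exponent at `1/3`. [cite: Strassen1988, Thm. 3.8] -/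
theorem exchangeExponent_le_third_of_helpedDeg (h : HelpedDeg 3 2) : exchangeExponent ≤ 1 / 3 := by
  simpa using exchangeExponent_le_inv_of_helpedDeg_two (by norm_num) h

/-- … which is STRICTLY below the `ω`-inherited bound `θ⋆ ≤ 0.37295` (tree `exchangeExponent_le_leGall`,
from Le Gall's `ω < 2.37287`): **the first `ω`-free improvement of the exchange exponent would follow
from one border certificate at `(3,2)`.** [cite: LeGall2014, Table 2] -/
theorem exchangeExponent_lt_leGall_of_helpedDeg (h : HelpedDeg 3 2) : exchangeExponent < 0.37295 := by
  have := exchangeExponent_le_third_of_helpedDeg h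
  norm_num at this ⊢
  linarith

/-- The same for the restriction door: `Helped 3 2 ⟹ θ⋆ ≤ 1/3`. [cite: Strassen1988, Thm. 3.8] -/
theorem exchangeExponent_le_third_of_helped (h : Helped 3 2) : exchangeExponent ≤ 1 / 3 :=
  exchangeExponent_le_third_of_helpedDeg (helpedDeg_of_helped h)

/-- **`HelpedDeg 4 2 ⟹ θ⋆ ≤ 1/4`** (two helpers at level four). [cite: Strassen1988, Thm. 3.8] -/
theorem exchangeExponent_le_quarter_of_helpedDeg (h : HelpedDeg 4 2) : exchangeExponent ≤ 1 / 4 := by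
  simpa using exchangeExponent_le_inv_of_helpedDeg_two (by norm_num) h

/-- **The border dichotomy at the criminal**: either `r̲(N) = 2` for every `N ≥ 1` — and then the leaf
`BlockOneIsMM` HOLDS — or some level has `r̲(N) ≥ 3`. [cite: Strassen1988, Thm. 3.8] -/
theorem border_twoCopies_dichotomy :
    (∀ N : ℕ, 1 ≤ N → borderExchangeNumber N = 2) ∧ Theses.OutsiderSandwich.BlockOneIsMM ∨
      ∃ N : ℕ, 1 ≤ N ∧ 3 ≤ borderExchangeNumber N := by
  by_cases h : ∀ N : ℕ, 1 ≤ N → borderExchangeNumber N = 2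
  · exact Or.inl ⟨h, blockOneIsMM_of_forall_helpedDeg_two fun N hN =>
      helpedDeg_iff_borderExchangeNumber_le.2 (h N hN).le⟩
  · push Not at h
    obtain ⟨N, hN, hne⟩ := h
    exact Or.inr ⟨N, hN, by have := two_le_borderExchangeNumber hN; omega⟩

end Summit.MatrixMultiplication.MatrixMultiplication.Theorems.OutsiderSandwichBorderCriminal

end
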